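import Summits.QuantumFields.YangMills.Theorems.BalabanUVNodesN11SpaceTruncationCharged
import Literature.MathematicalPhysics.QuantumFieldTheory.Balaban1983to89.B14SeparationOfRecord

/-!
# DAG node N11 — door (d4) AT THE CHARGED SEPARATED INDICES OF THE RECORD: the no-expansion 𝐓-step keyed on the record row `bg` and the junction hJ at CHARGED
# indices ONLY — p591971's print-void residue `hNS` at non-separated indices ELIMINATED (a charged index is separated, dag-n11-e g6 `B14SeparationOfRecord`)

HEADER — WORK-UNIT METADATA.  Cell `pub-ymgap`, YM-PLAN Track A (HUMAN RULING D-0062), seat `pub-ymgap-dag-n11-d` (g12; R134 fan-out seat N11 [B14], strategy s2),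
route `BalabanUVNodes`, item K1⁷ `StabilityBAtRecordR13SepCoPH` = stmt-QuantumFields-20542 (helper, `--kind proof --supports 20542 --as helper`, count-neutral).
[III] = [Balaban1988Convergent], [6] = [Balaban1985RegularSpaces], [15] = [Balaban1985Variational].  Over the sibling `…N11SpaceTruncationCharged` (★★★ ∕ ★★★★ faces with the
background proviso over the CHARGED reading support), p591971 `…N11SpaceTruncationAtSepIndices` (`sepJunction_of_top`, re-derived here with the charge), dag-n11-e g6's
`Literature/…/B14SeparationOfRecord` (★★ `seqSeparated_of_slotsOfRecord₁₃_ne_zero_of_M₁_le_M`, cited not restated), def-T's `Record13SepCoPH` (row `Provisos₁₃SepCoPH.bg`,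
`suppOfRecord₁₃SepCoP`, `PartCompat₁₃`), def-R's `BgProvisoΛ`.

WHY THIS FILE.  p591971 split the background hypothesis of door (d4) three-way: record row `bg` (over the separated (7)-regular support) + junction hJ at SEPARATED indices +
the print-void residue hNS at NON-separated indices (displayed; «def-T ∕ K0 decide: restrict the §2 clause to separated indices, or pin the slots to 0 off them»).  The tree
ALREADY pins them: dag-n11-e g6's `B14SeparationOfRecord` proves that every index CHARGED by `ρ_k` of record (`slotsOfRecord … k s₀ ≠ 0`) is `Sect2.SeqSeparated θ.ν.M₁`
under the grid comparison `0 < M₁ ≤ M` (K0a's witnesses: `M₁ = M = 1`), and the sibling file shows the proviso is read at charged indices only.  So hNS is VOID IN THE TREE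
as well as in print: the no-expansion 𝐓-step is keyed on `bg` + hJ at charged (hence separated) indices, nothing else of the background.

WHAT THIS FILE PROVES (0 `sorry`, 0 `def`; pure logic over the sibling's faces).
* `bgProvisoΛ_charged_of_sep_of_junctionCharged` — record row over the separated (7)-regular support + junction at charged separated indices ⇒ `BgProvisoΛ` over the CHARGED
  reading support (`0 < M₁ ≤ M`).
* ★ `exists_local_witness_clause_succ_of_sLaw₁₃CoPH_of_sep_of_junctionCharged` — the SLaw-keyed face on `Provisos₁₃SepCoPH.bg` + `PartCompat₁₃` + hJ at charged separated indices.
* ★ `exists_local_witness_clause_succ_of_hasSect2FormAtZS_of_borelB_of_sep_of_junctionCharged` — the witness-first face, same keys.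
* `sepJunctionCharged_of_top` — for print's reading regions (`readSelOfSeq`, letter `θ.s2.cR`) the charged junction IS a top-scale statement at charged separated indices
  (p591971's `sepJunction_of_top` with the charge available to the discharger).

HONEST FRAMING.  Helper lane of K1⁷; bookkeeping; nothing of Bałaban's is asserted; hJ (def-R's R-half of [RFACE-11d]: top-scale regularity and the (7)-data from `χ_k ≠ 0`,
[15] Thm 1 + [B7] Prop. 2 on the solvable set) REMAINS displayed, now asked only where `ρ_k`'s slot is non-zero and the index is separated.  N11 NOT discharged; K1⁷ NOT
closed; counts unmoved (typed 28∕28 · discharged 5∕27).  One finite four-torus programme at fixed `ε = L^{−K}` — NOT ℝ⁴, NOT OS, NOT a mass gap, NOT Clay.  No `sorry`,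
`axiom`, `def`, `instance`, `notation`.  Sources (SHAPE only): [III] (2.1) p.254, (2.2) p.255, (2.10) p.256, (2.17)–(2.18) p.257, (2.28) p.259, Thm 1 p.262, (3.5) p.265,
(3.24)–(3.25) p.270; [6] (1.3)–(1.6) p.77; [15] (7) p.278.
-/

noncomputable section

open MeasureTheory
open scoped BigOperators ENNReal NNReal Matrix.Norms.L2Operator

namespace Summit.QuantumFields.YangMills.Theorems.BalabanUVNodesN11SpaceTruncationChargedSep

open Literature.MathematicalPhysics.QuantumFieldTheory.Balaban1983to89 T4Continuum T4NestedCovariance Node00 Node00.Tk DagBinding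
open B15DeterminingSets B8Eq17ClassAkV1
open BalabanUVNodesN11FluctTruncationDefs (IsFluctLocal)
open BalabanUVNodesN11SpaceTruncationDefs BalabanUVNodesN11SpaceTruncationBorelBDefs
open BalabanUVNodesN11SpaceTruncationCharged (exists_local_witness_clause_succ_of_sLaw₁₃CoPH_of_bgReadCharged
  exists_local_witness_clause_succ_of_hasSect2FormAtZS_of_borelB_of_bgReadCharged)
open B14SeparationOfRecord (seqSeparated_of_slotsOfRecord₁₃_ne_zero_of_M₁_le_M)

variable {F : T4Family} {N : ℕ} [NeZero N]

variable (θ : Stage13HParams F N) (p : B12.RunParams)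

/-- **THE CHARGED READING PROVISO FROM THE RECORD ROW AND THE JUNCTION AT CHARGED SEPARATED INDICES — NO RESIDUE**: under the grid comparison `0 < M₁ ≤ M`
a charged index is `Sect2.SeqSeparated` (dag-n11-e g6), so def-R's `BgProvisoΛ` over the separated (7)-regular support plus the junction «charged ∧ separated ⇒
(χ-support × lower-scale regularity on the reading regions ⊆ separated (7)-regular support)» give `BgProvisoΛ` over the CHARGED reading support at every index.
[cite: Balaban1988Convergent, (2.28) p.259, (2.10) p.256, (2.1) p.254, (3.5) p.265; Balaban1985RegularSpaces, (1.3)–(1.6) p.77] -/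
theorem bgProvisoΛ_charged_of_sep_of_junctionCharged (hM₁ : 0 < θ.ν.M₁) (hle : θ.ν.M₁ ≤ θ.τ9.M) {k : ℕ} (cR : ℝ)
    (Γr : SeqOfRecord F θ.ν θ.τ9.M (gOfRecord₁₃ F N θ.toStage13Params p) p.K k → ℕ → Set (Site (F.P p.K) 0) → Set (Site (F.P p.K) 0))
    (hsep : BgProvisoΛ F N p.K (settingOfRecord₁₃ F N θ.toStage13Params p) (θ.Rz p.K) θ.τ9.M k (suppOfRecord₁₃SepCoP F N θ.toStage13Params p k)
      (UbgOfRecord₁₃CoP F N θ.toStage13Params p k))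
    (hJ : ∀ s₀, slotsOfRecord F N θ.ν θ.τ9 (EOfRecord₁₃ F N θ.toStage13Params) (wOfRecord₉ F N θ.toStage9Params) θ.ppSel p
        (gOfRecord₁₃ F N θ.toStage13Params p) k s₀ ≠ 0 → Sect2.SeqSeparated θ.ν.M₁ s₀ → ∀ Wc : MSField (F.P p.K) (SU N),
      chiSeqOfRecord F N θ.ν θ.τ9.M (gOfRecord₁₃ F N θ.toStage13Params p) p.K k s₀ (Wc k) ≠ 0 →
      (∀ j, j < k → PlaqSmallOn (plaqsOf (pts j (Γr s₀ j (s₀.Ω (j + 1))ᶜ))) (cR * epsOfRecord θ.ν (gOfRecord₁₃ F N θ.toStage13Params p) j) (Wc j)) →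
      Wc ∈ suppOfRecord₁₃SepCoP F N θ.toStage13Params p k s₀) :
    BgProvisoΛ F N p.K (settingOfRecord₁₃ F N θ.toStage13Params p) (θ.Rz p.K) θ.τ9.M k
      (fun s₀ => {Wc | slotsOfRecord F N θ.ν θ.τ9 (EOfRecord₁₃ F N θ.toStage13Params) (wOfRecord₉ F N θ.toStage9Params) θ.ppSel p
          (gOfRecord₁₃ F N θ.toStage13Params p) k s₀ ≠ 0 ∧
        chiSeqOfRecord F N θ.ν θ.τ9.M (gOfRecord₁₃ F N θ.toStage13Params p) p.K k s₀ (Wc k) ≠ 0 ∧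
        ∀ j, j < k → PlaqSmallOn (plaqsOf (pts j (Γr s₀ j (s₀.Ω (j + 1))ᶜ))) (cR * epsOfRecord θ.ν (gOfRecord₁₃ F N θ.toStage13Params p) j) (Wc j)})
      (UbgOfRecord₁₃CoP F N θ.toStage13Params p k) := by
  intro s₀ Wc hWc j h1 hj X
  exact hsep s₀ Wc (hJ s₀ hWc.1 (seqSeparated_of_slotsOfRecord₁₃_ne_zero_of_M₁_le_M F N p θ.toStage13Params hM₁ hle s₀ hWc.1) Wc hWc.2.1 hWc.2.2) j h1 hj X

/-- **★ THE SLaw-KEYED FACE AT THE CHARGED SEPARATED INDICES OF THE RECORD — NO PRINT-VOID RESIDUE**: the sibling's ★★★ keyed on the record row `Provisos₁₃SepCoPH.bg`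
(window + `PartCompat₁₃`), the junction hJ at CHARGED SEPARATED indices, 12a″'s `RegOn`, the run ∕ numerics rows and the grid comparison `0 < M₁ ≤ M`; conclusion
VERBATIM p589738's. [cite: Balaban1988Convergent, Theorem p.245, Thm 1 p.262, (2.1) p.254, (2.7) p.255, (2.10) p.256, (2.28) p.259, (3.5) p.265, (3.24)–(3.25) p.270; Balaban1985RegularSpaces, (1.3)–(1.6) p.77] -/
theorem exists_local_witness_clause_succ_of_sLaw₁₃CoPH_of_sep_of_junctionCharged (hsep : θ.Provisos₁₃SepCoPH F N) (hU : θ.ZhUnity F N) (hθ : θ.Admissible F N)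
    (hpos : θ.s2.Pos) (hM₁ : 0 < θ.ν.M₁) (hle : θ.ν.M₁ ≤ θ.τ9.M) {k : ℕ} (hk : k < p.K) (hM : 1 ≤ θ.τ9.M)
    (hw : Step.InInterval θ.γ k (gOfRecord₁₃ F N θ.toStage13Params p)) (hPC : PartCompat₁₃ F N θ.toStage13Params p k) (cR : ℝ)
    (Γr : SeqOfRecord F θ.ν θ.τ9.M (gOfRecord₁₃ F N θ.toStage13Params p) p.K k → ℕ → Set (Site (F.P p.K) 0) → Set (Site (F.P p.K) 0))
    (hreg : ∀ s₀, (θ.zhAt p s₀).RegOn F N (FluctV N) θ.ν cR p (gOfRecord₁₃ F N θ.toStage13Params p) (Γr s₀))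
    (hJ : ∀ s₀, slotsOfRecord F N θ.ν θ.τ9 (EOfRecord₁₃ F N θ.toStage13Params) (wOfRecord₉ F N θ.toStage9Params) θ.ppSel p
        (gOfRecord₁₃ F N θ.toStage13Params p) k s₀ ≠ 0 → Sect2.SeqSeparated θ.ν.M₁ s₀ → ∀ Wc : MSField (F.P p.K) (SU N),
      chiSeqOfRecord F N θ.ν θ.τ9.M (gOfRecord₁₃ F N θ.toStage13Params p) p.K k s₀ (Wc k) ≠ 0 →
      (∀ j, j < k → PlaqSmallOn (plaqsOf (pts j (Γr s₀ j (s₀.Ω (j + 1))ᶜ))) (cR * epsOfRecord θ.ν (gOfRecord₁₃ F N θ.toStage13Params p) j) (Wc j)) →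
      Wc ∈ suppOfRecord₁₃SepCoP F N θ.toStage13Params p k s₀)
    (hS : SLaw₁₃CoPH F N θ p k) :
    ∃ (t : SeqOfRecord F θ.ν θ.τ9.M (gOfRecord₁₃ F N θ.toStage13Params p) p.K k → Sect2.TermValues (F.P p.K) (MatA N) (FluctV N) θ.τ9.M)
      (Ek : SeqOfRecord F θ.ν θ.τ9.M (gOfRecord₁₃ F N θ.toStage13Params p) p.K k → ℝ),
      HasSect2FormAtZS F N (FluctV N) p.K (settingOfRecord₁₃ F N θ.toStage13Params p) k (θ.rzAt p) (WtOfRecord₁₃H F N θ p)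
          (UbgOfRecord₁₃CoP F N θ.toStage13Params p k)
          (fun s₀ t₀ => Sect2.LawsRT (sect2TowerOfRecord F N (FluctV N) p.K (settingOfRecord₁₃ F N θ.toStage13Params p) (θ.rzAt p s₀) s₀ t₀)
            (settingOfRecord₁₃ F N θ.toStage13Params p).lf k)
          (slotsOfRecord F N θ.ν θ.τ9 (EOfRecord₁₃ F N θ.toStage13Params) (wOfRecord₉ F N θ.toStage9Params) θ.ppSel p
            (gOfRecord₁₃ F N θ.toStage13Params p) k) t Ek ∧
      (∀ s₀, IsFluctLocal k (t s₀)) ∧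
      ∀ (s : SeqOfRecord F θ.ν θ.τ9.M (gOfRecord₁₃ F N θ.toStage13Params p) p.K (k + 1)), s.Ω (k + 1) = ∅ →
        -- (P) prefix agreement below `k`
        (∀ j, j < k → (θ.zhAt p s).ζ0 j = (θ.zhAt p s.init).ζ0 j ∧ (θ.zhAt p s).quad j = (θ.zhAt p s.init).quad j) →
        -- (V) the generation-`k` pin with the old front factor
        (∀ (V' : GaugeField (F.P p.K) (k + 1) (SU N)) (U₀ : GaugeField (F.P p.K) k (SU N)),
          (θ.zhAt p s).ζ0 k Set.univ (pairCfgAt (V := FluctV N) k V' U₀) =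
            chiSeqOfRecord F N θ.ν θ.τ9.M (gOfRecord₁₃ F N θ.toStage13Params p) p.K k s.init U₀ *
              wOfRecord₉ F N θ.toStage9Params p (gOfRecord₁₃ F N θ.toStage13Params p) k s U₀ ((avOfRecord F N p.K k).avg U₀)) →
        -- `quad_k(∅) = 0` on the two-scale configurations
        (∀ (V' : GaugeField (F.P p.K) (k + 1) (SU N)) (U₀ : GaugeField (F.P p.K) k (SU N)), (θ.zhAt p s).quad k ∅ (pairCfgAt (V := FluctV N) k V' U₀) = 0) →
        -- `k`-locality of `quad_j(Λ_{j+1})`, `j < k`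
        (∀ j, j < k → ∀ ω ω' : MultiCfg (F.P p.K) (SU N) (FluctV N), (∀ i, i ≤ k → ω i = ω' i) →
          (θ.zhAt p s).quad j (s.init.Λ (j + 1)) ω = (θ.zhAt p s).quad j (s.init.Λ (j + 1)) ω') →
        -- measurability of the residual serving `s′`
        (∀ j (Y : Set (Site (F.P p.K) 0)), Measurable ((θ.zhAt p s).ζ0 j Y)) →
        (∀ j (Λ' : Set (Site (F.P p.K) 0)), Measurable ((θ.zhAt p s).quad j Λ')) →
        -- per old branch: A-fibre domination (K0b)
        (∀ S ∈ admSOfRecord F θ.ν θ.τ9.M (gOfRecord₁₃ F N θ.toStage13Params p) p.K k s.init, ∀ j : ℕ,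
          ∃ ŵ : (↥(Set.toFinite (B10Eq42TorusConstraint.bondsIn j ((s.init.Λ (j + 1))ᶜ ∩ s.init.Ω (j + 1)))).toFinset → FluctV N) → ℝ≥0∞, Measurable ŵ ∧
            (∫⁻ a, ŵ a ∂(Measure.pi fun _ : ↥(Set.toFinite (B10Eq42TorusConstraint.bondsIn j ((s.init.Λ (j + 1))ᶜ ∩ s.init.Ω (j + 1)))).toFinset => (volume : Measure (FluctV N)))) ≠ ⊤ ∧
            ∀ ω, ENNReal.ofReal ((WtOfRecord₁₃H F N θ p s).w j (s.init.Λ (j + 1)) ((s.init.Λ (j + 1))ᶜ ∩ s.init.Ω (j + 1)) (S (j + 1)) ω) ≤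
              ŵ (fun b : ↥(Set.toFinite (B10Eq42TorusConstraint.bondsIn j ((s.init.Λ (j + 1))ᶜ ∩ s.init.Ω (j + 1)))).toFinset => (ω j).2 b)) →
        -- def-T: the 𝐁-terms of the witness at the parent history, READ AT THE EMBEDDED BACKGROUND, are JOINTLY measurable in `(U, A)` (LOCATED residue)
        (∀ (S' : ℕ → Set (Site (F.P p.K) 0)) (j : ℕ) (X : (Sect2.domSys (F.P p.K) θ.τ9.M j).Dom),
          Measurable (fun q : GaugeField (F.P p.K) 0 (SU N) × MSFluct (F.P p.K) (FluctV N) =>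
            ((t s.init).B j X (Sect2.ofBackgroundC (settingOfRecord₁₃ F N θ.toStage13Params p).ι q.1) (S', q.2)).re)) →
        (slotsTOfRecord F N θ.ν θ.τ9 (EOfRecord₁₃ F N θ.toStage13Params) (wOfRecord₉ F N θ.toStage9Params) θ.ppSel p
            (gOfRecord₁₃ F N θ.toStage13Params p) (k + 1) s = 0 ∨
          ∀ᵐ V' ∂fieldMeasure (F.P p.K) (k + 1) (SU N),
            chiSeqOfRecord F N θ.ν θ.τ9.M (gOfRecord₁₃ F N θ.toStage13Params p) p.K (k + 1) s V' ≠ 0 →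
              slotsTOfRecord F N θ.ν θ.τ9 (EOfRecord₁₃ F N θ.toStage13Params) (wOfRecord₉ F N θ.toStage9Params) θ.ppSel p
                  (gOfRecord₁₃ F N θ.toStage13Params p) (k + 1) s V' =
                sect2Slot F N (FluctV N) p.K (settingOfRecord₁₃ F N θ.toStage13Params p) (θ.rzAt p s) (WtOfRecord₁₃H F N θ p s) s
                  (t s.init) (Ek s.init) (UbgOfRecord₁₃CoP F N θ.toStage13Params p (k + 1) s) V') :=
  exists_local_witness_clause_succ_of_sLaw₁₃CoPH_of_bgReadCharged θ p hsep.toCore hU hθ hpos hk hM hw cR Γr hreg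
    (bgProvisoΛ_charged_of_sep_of_junctionCharged θ p hM₁ hle cR Γr (hsep.bg p k hk.le hw hPC) hJ) hS

/-- **★ THE WITNESS-FIRST FACE AT THE CHARGED SEPARATED INDICES OF THE RECORD — NO PRINT-VOID RESIDUE**: the sibling's ★★★★ keyed on the record row `bg`, the junction
hJ at CHARGED SEPARATED indices and `0 < M₁ ≤ M`; conclusion VERBATIM p591695's (no row on the witness). [cite: Balaban1988Convergent, Theorem p.245, Thm 1 p.262, (2.1) p.254, (2.7) p.255, (2.10) p.256, (2.28) p.259, (3.5) p.265, (3.24)–(3.25) p.270; Balaban1985RegularSpaces, (1.3)–(1.6) p.77] -/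
theorem exists_local_witness_clause_succ_of_hasSect2FormAtZS_of_borelB_of_sep_of_junctionCharged (hsep : θ.Provisos₁₃SepCoPH F N) (hU : θ.ZhUnity F N)
    (hθ : θ.Admissible F N) (hpos : θ.s2.Pos) (hM₁ : 0 < θ.ν.M₁) (hle : θ.ν.M₁ ≤ θ.τ9.M) {k : ℕ} (hk : k < p.K) (hM : 1 ≤ θ.τ9.M)
    (hw : Step.InInterval θ.γ k (gOfRecord₁₃ F N θ.toStage13Params p)) (hPC : PartCompat₁₃ F N θ.toStage13Params p k) (cR : ℝ)
    (Γr : SeqOfRecord F θ.ν θ.τ9.M (gOfRecord₁₃ F N θ.toStage13Params p) p.K k → ℕ → Set (Site (F.P p.K) 0) → Set (Site (F.P p.K) 0))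
    (hreg : ∀ s₀, (θ.zhAt p s₀).RegOn F N (FluctV N) θ.ν cR p (gOfRecord₁₃ F N θ.toStage13Params p) (Γr s₀))
    (hJ : ∀ s₀, slotsOfRecord F N θ.ν θ.τ9 (EOfRecord₁₃ F N θ.toStage13Params) (wOfRecord₉ F N θ.toStage9Params) θ.ppSel p
        (gOfRecord₁₃ F N θ.toStage13Params p) k s₀ ≠ 0 → Sect2.SeqSeparated θ.ν.M₁ s₀ → ∀ Wc : MSField (F.P p.K) (SU N),
      chiSeqOfRecord F N θ.ν θ.τ9.M (gOfRecord₁₃ F N θ.toStage13Params p) p.K k s₀ (Wc k) ≠ 0 →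
      (∀ j, j < k → PlaqSmallOn (plaqsOf (pts j (Γr s₀ j (s₀.Ω (j + 1))ᶜ))) (cR * epsOfRecord θ.ν (gOfRecord₁₃ F N θ.toStage13Params p) j) (Wc j)) →
      Wc ∈ suppOfRecord₁₃SepCoP F N θ.toStage13Params p k s₀)
    (t₀ : SeqOfRecord F θ.ν θ.τ9.M (gOfRecord₁₃ F N θ.toStage13Params p) p.K k → Sect2.TermValues (F.P p.K) (MatA N) (FluctV N) θ.τ9.M)
    (E₀ : SeqOfRecord F θ.ν θ.τ9.M (gOfRecord₁₃ F N θ.toStage13Params p) p.K k → ℝ)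
    (hform₀ : HasSect2FormAtZS F N (FluctV N) p.K (settingOfRecord₁₃ F N θ.toStage13Params p) k (θ.rzAt p) (WtOfRecord₁₃H F N θ p)
      (UbgOfRecord₁₃CoP F N θ.toStage13Params p k)
      (fun s₀ t' => Sect2.LawsRT (sect2TowerOfRecord F N (FluctV N) p.K (settingOfRecord₁₃ F N θ.toStage13Params p) (θ.rzAt p s₀) s₀ t')
        (settingOfRecord₁₃ F N θ.toStage13Params p).lf k)
      (slotsOfRecord F N θ.ν θ.τ9 (EOfRecord₁₃ F N θ.toStage13Params) (wOfRecord₉ F N θ.toStage9Params) θ.ppSel p (gOfRecord₁₃ F N θ.toStage13Params p) k) t₀ E₀)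
    (hBt : ∀ s₀ (S' : ℕ → Set (Site (F.P p.K) 0)) (j : ℕ) (X : (Sect2.domSys (F.P p.K) θ.τ9.M j).Dom),
      Measurable (fun q : GaugeField (F.P p.K) 0 (SU N) × MSFluct (F.P p.K) (FluctV N) =>
        (t₀ s₀).B j X (Sect2.ofBackgroundC (settingOfRecord₁₃ F N θ.toStage13Params p).ι q.1) (S', q.2))) :
    ∃ (t : SeqOfRecord F θ.ν θ.τ9.M (gOfRecord₁₃ F N θ.toStage13Params p) p.K k → Sect2.TermValues (F.P p.K) (MatA N) (FluctV N) θ.τ9.M)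
      (Ek : SeqOfRecord F θ.ν θ.τ9.M (gOfRecord₁₃ F N θ.toStage13Params p) p.K k → ℝ),
      HasSect2FormAtZS F N (FluctV N) p.K (settingOfRecord₁₃ F N θ.toStage13Params p) k (θ.rzAt p) (WtOfRecord₁₃H F N θ p)
          (UbgOfRecord₁₃CoP F N θ.toStage13Params p k)
          (fun s₀ t₀ => Sect2.LawsRT (sect2TowerOfRecord F N (FluctV N) p.K (settingOfRecord₁₃ F N θ.toStage13Params p) (θ.rzAt p s₀) s₀ t₀)
            (settingOfRecord₁₃ F N θ.toStage13Params p).lf k)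
          (slotsOfRecord F N θ.ν θ.τ9 (EOfRecord₁₃ F N θ.toStage13Params) (wOfRecord₉ F N θ.toStage9Params) θ.ppSel p
            (gOfRecord₁₃ F N θ.toStage13Params p) k) t Ek ∧
      (∀ s₀, IsFluctLocal k (t s₀)) ∧
      ∀ (s : SeqOfRecord F θ.ν θ.τ9.M (gOfRecord₁₃ F N θ.toStage13Params p) p.K (k + 1)), s.Ω (k + 1) = ∅ →
        -- (P) prefix agreement below `k`
        (∀ j, j < k → (θ.zhAt p s).ζ0 j = (θ.zhAt p s.init).ζ0 j ∧ (θ.zhAt p s).quad j = (θ.zhAt p s.init).quad j) →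
        -- (V) the generation-`k` pin with the old front factor
        (∀ (V' : GaugeField (F.P p.K) (k + 1) (SU N)) (U₀ : GaugeField (F.P p.K) k (SU N)),
          (θ.zhAt p s).ζ0 k Set.univ (pairCfgAt (V := FluctV N) k V' U₀) =
            chiSeqOfRecord F N θ.ν θ.τ9.M (gOfRecord₁₃ F N θ.toStage13Params p) p.K k s.init U₀ *
              wOfRecord₉ F N θ.toStage9Params p (gOfRecord₁₃ F N θ.toStage13Params p) k s U₀ ((avOfRecord F N p.K k).avg U₀)) →
        -- `quad_k(∅) = 0` on the two-scale configurations
        (∀ (V' : GaugeField (F.P p.K) (k + 1) (SU N)) (U₀ : GaugeField (F.P p.K) k (SU N)), (θ.zhAt p s).quad k ∅ (pairCfgAt (V := FluctV N) k V' U₀) = 0) →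
        -- `k`-locality of `quad_j(Λ_{j+1})`, `j < k`
        (∀ j, j < k → ∀ ω ω' : MultiCfg (F.P p.K) (SU N) (FluctV N), (∀ i, i ≤ k → ω i = ω' i) →
          (θ.zhAt p s).quad j (s.init.Λ (j + 1)) ω = (θ.zhAt p s).quad j (s.init.Λ (j + 1)) ω') →
        -- measurability of the residual serving `s′`
        (∀ j (Y : Set (Site (F.P p.K) 0)), Measurable ((θ.zhAt p s).ζ0 j Y)) →
        (∀ j (Λ' : Set (Site (F.P p.K) 0)), Measurable ((θ.zhAt p s).quad j Λ')) →
        -- per old branch: A-fibre domination (K0b)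
        (∀ S ∈ admSOfRecord F θ.ν θ.τ9.M (gOfRecord₁₃ F N θ.toStage13Params p) p.K k s.init, ∀ j : ℕ,
          ∃ ŵ : (↥(Set.toFinite (B10Eq42TorusConstraint.bondsIn j ((s.init.Λ (j + 1))ᶜ ∩ s.init.Ω (j + 1)))).toFinset → FluctV N) → ℝ≥0∞, Measurable ŵ ∧
            (∫⁻ a, ŵ a ∂(Measure.pi fun _ : ↥(Set.toFinite (B10Eq42TorusConstraint.bondsIn j ((s.init.Λ (j + 1))ᶜ ∩ s.init.Ω (j + 1)))).toFinset => (volume : Measure (FluctV N)))) ≠ ⊤ ∧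
            ∀ ω, ENNReal.ofReal ((WtOfRecord₁₃H F N θ p s).w j (s.init.Λ (j + 1)) ((s.init.Λ (j + 1))ᶜ ∩ s.init.Ω (j + 1)) (S (j + 1)) ω) ≤
              ŵ (fun b : ↥(Set.toFinite (B10Eq42TorusConstraint.bondsIn j ((s.init.Λ (j + 1))ᶜ ∩ s.init.Ω (j + 1)))).toFinset => (ω j).2 b)) →
        (slotsTOfRecord F N θ.ν θ.τ9 (EOfRecord₁₃ F N θ.toStage13Params) (wOfRecord₉ F N θ.toStage9Params) θ.ppSel p
            (gOfRecord₁₃ F N θ.toStage13Params p) (k + 1) s = 0 ∨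
          ∀ᵐ V' ∂fieldMeasure (F.P p.K) (k + 1) (SU N),
            chiSeqOfRecord F N θ.ν θ.τ9.M (gOfRecord₁₃ F N θ.toStage13Params p) p.K (k + 1) s V' ≠ 0 →
              slotsTOfRecord F N θ.ν θ.τ9 (EOfRecord₁₃ F N θ.toStage13Params) (wOfRecord₉ F N θ.toStage9Params) θ.ppSel p
                  (gOfRecord₁₃ F N θ.toStage13Params p) (k + 1) s V' =
                sect2Slot F N (FluctV N) p.K (settingOfRecord₁₃ F N θ.toStage13Params p) (θ.rzAt p s) (WtOfRecord₁₃H F N θ p s) s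
                  (t s.init) (Ek s.init) (UbgOfRecord₁₃CoP F N θ.toStage13Params p (k + 1) s) V') :=
  exists_local_witness_clause_succ_of_hasSect2FormAtZS_of_borelB_of_bgReadCharged θ p hsep.toCore hU hθ hpos hk hM hw cR Γr hreg
    (bgProvisoΛ_charged_of_sep_of_junctionCharged θ p hM₁ hle cR Γr (hsep.bg p k hk.le hw hPC) hJ) t₀ E₀ hform₀ hBt

/-! ## The charged junction, for print's reading regions, REDUCED TO ITS TOP-SCALE PART -/

/-- **THE CHARGED JUNCTION IS A TOP-SCALE STATEMENT** (`1 ≤ k`, print's reading regions `Γr s₀ := readSelOfSeq (suppDom) s₀.Ω`, letter `cR := θ.s2.cR`): as p591971's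
`sepJunction_of_top`, with the CHARGE `slotsOfRecord … k s₀ ≠ 0` available to the discharger of the top clause «`χ_k(s₀)(W_k) ≠ 0 ⇒` top regularity ∧ (7)-data».
[cite: Balaban1988Convergent, (2.2) p.255, (2.10) p.256, (2.17) p.257, (2.28) p.259; Balaban1985RegularSpaces, (1.3)–(1.6) p.77; Balaban1985Variational, (7) p.278] -/
theorem sepJunctionCharged_of_top {k : ℕ} (hk : 1 ≤ k)
    (hTop : ∀ s₀ : SeqOfRecord F θ.ν θ.τ9.M (gOfRecord₁₃ F N θ.toStage13Params p) p.K k,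
      slotsOfRecord F N θ.ν θ.τ9 (EOfRecord₁₃ F N θ.toStage13Params) (wOfRecord₉ F N θ.toStage9Params) θ.ppSel p
        (gOfRecord₁₃ F N θ.toStage13Params p) k s₀ ≠ 0 → Sect2.SeqSeparated θ.ν.M₁ s₀ → ∀ Wc : MSField (F.P p.K) (SU N),
      chiSeqOfRecord F N θ.ν θ.τ9.M (gOfRecord₁₃ F N θ.toStage13Params p) p.K k s₀ (Wc k) ≠ 0 →
      (∀ j, j < k → PlaqSmallOn (plaqsOf (pts j (readSelOfSeq F p (suppDomOfRecord F θ.ν p.K s₀.Ω) s₀.Ω j (s₀.Ω (j + 1))ᶜ)))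
        (θ.s2.cR * epsOfRecord θ.ν (gOfRecord₁₃ F N θ.toStage13Params p) j) (Wc j)) →
      PlaqSmallOn (plaqsOf (genSet s₀.Ω k k)) (θ.s2.cR * epsOfRecord θ.ν (gOfRecord₁₃ F N θ.toStage13Params p) k) (Wc k) ∧
        Sect2.DataSmall7PTop (avOfRecord F N p.K) s₀.Ω (suppDomOfRecord F θ.ν p.K s₀.Ω) k
          (fun j => θ.s2.cR * epsOfRecord θ.ν (gOfRecord₁₃ F N θ.toStage13Params p) j) Wc) :
    ∀ s₀ : SeqOfRecord F θ.ν θ.τ9.M (gOfRecord₁₃ F N θ.toStage13Params p) p.K k,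
      slotsOfRecord F N θ.ν θ.τ9 (EOfRecord₁₃ F N θ.toStage13Params) (wOfRecord₉ F N θ.toStage9Params) θ.ppSel p
        (gOfRecord₁₃ F N θ.toStage13Params p) k s₀ ≠ 0 → Sect2.SeqSeparated θ.ν.M₁ s₀ → ∀ Wc : MSField (F.P p.K) (SU N),
      chiSeqOfRecord F N θ.ν θ.τ9.M (gOfRecord₁₃ F N θ.toStage13Params p) p.K k s₀ (Wc k) ≠ 0 →
      (∀ j, j < k → PlaqSmallOn (plaqsOf (pts j (readSelOfSeq F p (suppDomOfRecord F θ.ν p.K s₀.Ω) s₀.Ω j (s₀.Ω (j + 1))ᶜ)))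
        (θ.s2.cR * epsOfRecord θ.ν (gOfRecord₁₃ F N θ.toStage13Params p) j) (Wc j)) →
      Wc ∈ suppOfRecord₁₃SepCoP F N θ.toStage13Params p k s₀ := by
  intro s₀ hch hs Wc hχ hlow
  obtain ⟨htop, h7⟩ := hTop s₀ hch hs Wc hχ hlow
  refine (mem_suppOfRecord₁₃SepCoP_iff F N θ.toStage13Params p k s₀ Wc).mpr ⟨⟨?_, fun j h1 hj => ?_⟩, hs, h7⟩
  · have h0 := hlow 0 hk
    rw [readSelOfSeq_zero_compl, pts_zero] at h0
    exact h0
  · rcases Nat.lt_or_eq_of_le hj with hlt | rfl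
    · have h1' := hlow j hlt
      rw [readSelOfSeq_compl_eq_gammaRegion _ _ h1 hlt] at h1'
      exact h1'
    · exact htop

end Summit.QuantumFields.YangMills.Theorems.BalabanUVNodesN11SpaceTruncationChargedSep

end
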